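import Summits.Ventures.PercRepro.RankLevelSetLevelSevenRowThirtyNineChain
import Summits.Ventures.PercRepro.RankLevelSetLevelSevenRowThirtyEight

/-!
# PercRepro — THE ROW `38` OF LEVEL `7`: C-025 AT `q = 7` FOR EVERY FINITE MATROID AND EVERY `p ≥ 38`, ON THE
TELESCOPING COUNT WITH THE NULLITY SPLIT IN k STEPS, THE BONFERRONI CORRECTION AT LEVEL 7, THE SPLIT Y-TAIL, THE RE-BASED
TRIANGLE COUNT `triBound8` (THE KERNEL AT NULLITY `5`, THE RESTRICTION-REFINED BOOTSTRAP) AND p1 g29's EXACT s₄ CHAIN WITH ITS CONTINUATION IN THE S4 SLOT AT `d = 8 … 20` (p8, gen 23; a feeder for S4 — the top of the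
`q = 7` window moves from `39` to `38`)

Each row from the row above and its own rank: `c025_seven_large_<word> (P ≤ p) : RLS M p 7` is `c025_seven_at_<word>`
(RankLevelSetLevelSevenRow<Word>) at `p = P` and the row `P + 1` above it; the row `40` is `c025_seven_large_forty`
(RankLevelSetLevelSevenRowThirtyNineChain). The chain reaches `38`; the literal `C025` body at `38`
(`c025_seven_thirty_eight`). Axioms: standard.
-/

open scoped Matroid

namespace PercRepro

namespace ThmN

variable {α : Type}

/-- **THEOREM C₇ AT `38`, UNCONDITIONAL OVER THE TREE**: every finite matroid satisfies C-025 at level `7` for every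
`p ≥ 38` — the row `38` by `c025_seven_at_thirty_eight`, the rows `≥ 39` by `c025_seven_large_thirty_nine`. -/
theorem c025_seven_large_thirty_eight (M : Matroid α) [M.Finite] (p : ℕ) (hp : 38 ≤ p) : RLS M p 7 := by
  rcases Nat.lt_or_ge p 39 with h | h
  · have h38 : p = 38 := by omega
    subst h38
    exact c025_seven_at_thirty_eight M
  · exact c025_seven_large_thirty_nine M p h

/-- The same in the literal `C025` body: `phiK p 7 · #U(p, 7) ≤ #Y(p, 7)` for every finite matroid and every `p ≥ 38`. -/
theorem c025_seven_thirty_eight (M : Matroid α) [M.Finite] (p : ℕ) (hp : 38 ≤ p) :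
    phiK p 7 * ({A : Set α | A ⊆ M.E ∧ M.eRk A = (p : ℕ∞) ∧ M.eRk (M.E \ A) = (7 : ℕ∞)}.ncard : ℚ) ≤
      ({A : Set α | A ⊆ M.E ∧ (7 : ℕ∞) < M.eRk A ∧ M.eRk A < (p : ℕ∞)}.ncard : ℚ) :=
  c025_seven_large_thirty_eight M p hp

end ThmN

end PercRepro
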